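import Summits.ResolutionOfSingularities.ResolutionOfSingularities.Theorems.WeightedInvariantContactCylinderIota
import Summits.ResolutionOfSingularities.ResolutionOfSingularities.Theorems.WeightedInvariantContactCylinderLocalize
import Summits.ResolutionOfSingularities.ResolutionOfSingularities.Theorems.WeightedInvariantIotaLex
import HarnessLib

/-!
# The cylinder READINGS localise along the stratum: `iotaCylinder ι₀ ι₁` and `jCylinder ι₀ J` at a generisation on the top
# `ι₀`-stratum, for ABSTRACT letters — (o44) part (c7-cyl) (door `HypersurfaceCentreConstruction`,
# stmt-ResolutionOfSingularities-19897; rung P3 `stub_keyRungLE_three`; res-type-005 for res-L1-w43-plan-1's ORDER (o44),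
# TAKING-UNLESS-OBJECTED HOME/STATUS 2026-08-27T13:36:52Z)

Topic: `Summits/ResolutionOfSingularities/ResolutionOfSingularities/Theorems`. Helper for the door item
`HypersurfaceCentreConstruction` (stmt-ResolutionOfSingularities-19897, route `WeightedInvariant`), def-free.  The P3 letters
of record are `ι₃ᵗ = iotaLex Λ ι₀ (iotaCylinder ι₀ σ)` and `J₃ᵗ = jCylinder ι₀ J` (IOTA3-DESIGN v1.3 §8.2/§8.3, res-type-061
p527951 / res-type-005 p524206): the later letter and the centre filtration are READ AT THE GENERIC POINT of the top
`ι₀`-stratum.  For the clause (c7) «no increase under generisation» of `ι₃ᵗ` the lexicographic transfer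
(`iotaLex_generizationMonotone`, res-type-073 p504861) needs, at primes `𝔮` where `ι₀` is STATIONARY, that the cylinder
reading does not increase — in fact it is CONSTANT, because the top stratum, its generic prime and the reading ring all
localise.  res-D-brk-1 proved this for the first letter `ι₀ = iotaOrd` (`…ContactCylinderLocalize`, p527245); this file is the
same one letter up, for ANY iso-invariant `ι₀` with the (strat) identification `topStratum ι₀ S f = V(𝔭)` as hypothesis (the
shape delivered by res-type-078's `Iota3.topStratum_iotaOrdEps_eq` and res-type-013's (strat-τ)):

* `iota_atPrime_atPrime_eq` — `ι ((S_𝔮)_{𝔮₀'}) (f/1) = ι (S_{𝔮₀' ∩ S}) (f/1)` ((c6) along `(S_𝔮)_{𝔮₀'} ≅ S_{𝔮₀' ∩ S}`);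
* `mem_topStratum_localization_iff`, **`topStratum_localization_of_eq`** (`= V(𝔭 S_𝔮)`), `topStratumPrime_localization_eq`;
* **`iotaCylinder_localization_eq`** — `iotaCylinder ι₀ ι₁ (S_𝔮) (f/1) = iotaCylinder ι₀ ι₁ S f` for `𝔮 ⊇ 𝔭` (ι₁ iso-invariant);
* **`jCylinder_localization`** — `jCylinder ι₀ J (S_𝔮) (f/1) m = (jCylinder ι₀ J S f m)·S_𝔮` (J iso-invariant; brk-1's
  `cylinderAt_localization`) = the (J-loc) conjunct for `J₃ᵗ` at every position with the (strat) identification;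
* **`iotaCylinder_localization_le_of_strat`** — the (c7-cyl) inequality at a position with the (strat) property, in the
  binder shape of `IotaGenerizationMonotoneOn ι₀ (iotaCylinder ι₀ ι₁)`, and `iotaLex_iotaCylinder_localization_le` — the full
  lexicographic (c7) inequality at such a position from (c7) for `ι₀` there.

[OURS · L1 W4.3 · (o44) (c7-cyl)]  Replaces the role of NO printed item; NOT a statement of the manuscript
[claim: Hironaka2017, status: under-review]. AI work, weaker than expert review.  (c10-cyl) (torus factor) is NOT in this
file.

## References

* H. Matsumura, Commutative Ring Theory (1987), Thm. 4.3 (localisation at a prime; `(S_𝔮)_{𝔭 S_𝔮} = S_𝔭`). [Matsumura1987]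
* res-L1-w43-plan-1, IOTA3-DESIGN v1.3.1 §9.5 (c7-cyl) (OURS, AI planning).
-/

noncomputable section

open IsLocalRing Literature.AlgebraicGeometry.Resolution
open Summit.ResolutionOfSingularities.ResolutionOfSingularities.Cruxes.HypersurfaceCentreConstruction.LocalEngine

set_option linter.dupNamespace false -- mandated namespace of this single-conjunct summit

namespace Summit.ResolutionOfSingularities.ResolutionOfSingularities.Theorems

namespace ContactCylinder

section Strat

variable {ι₀ : (R : Type) → [CommRing R] → R → Ordinal.{0}} (hι₀ : IotaIsoInvariant ι₀)

/-- **A letter at a prime of a localisation is the letter at the contracted prime**: for an iso-invariant `ι` and a prime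
`𝔮₀'` of `S_𝔮`, `ι ((S_𝔮)_{𝔮₀'}) (f/1) = ι (S_{𝔮₀' ∩ S}) (f/1)` (`(S_𝔮)_{𝔮₀'} ≅ S_{𝔮₀' ∩ S}` over `S`, Mathlib
`IsLocalization.isLocalization_atPrime_localization_atPrime`). [cite: Matsumura1987, Thm. 4.3] -/
theorem iota_atPrime_atPrime_eq {ι : (R : Type) → [CommRing R] → R → Ordinal.{0}} (hι : IotaIsoInvariant ι)
    (S : Type) [CommRing S] (𝔮 : Ideal S) [𝔮.IsPrime] (f : S) (𝔮₀' : PrimeSpectrum (Localization.AtPrime 𝔮)) :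
    ι (Localization.AtPrime 𝔮₀'.asIdeal)
        (algebraMap (Localization.AtPrime 𝔮) (Localization.AtPrime 𝔮₀'.asIdeal)
          (algebraMap S (Localization.AtPrime 𝔮) f)) =
      ι (Localization.AtPrime (𝔮₀'.asIdeal.comap (algebraMap S (Localization.AtPrime 𝔮))))
        (algebraMap S _ f) := by
  let e : Localization.AtPrime 𝔮₀'.asIdeal ≃+*
      Localization.AtPrime (𝔮₀'.asIdeal.comap (algebraMap S (Localization.AtPrime 𝔮))) :=
    (IsLocalization.algEquiv (𝔮₀'.asIdeal.comap (algebraMap S (Localization.AtPrime 𝔮))).primeCompl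
      (Localization.AtPrime 𝔮₀'.asIdeal)
      (Localization.AtPrime (𝔮₀'.asIdeal.comap (algebraMap S (Localization.AtPrime 𝔮))))).toRingEquiv
  have he : e (algebraMap S _ f) = algebraMap S _ f :=
    (IsLocalization.algEquiv (𝔮₀'.asIdeal.comap (algebraMap S (Localization.AtPrime 𝔮))).primeCompl
      (Localization.AtPrime 𝔮₀'.asIdeal)
      (Localization.AtPrime (𝔮₀'.asIdeal.comap (algebraMap S (Localization.AtPrime 𝔮))))).commutes f
  rw [← IsScalarTower.algebraMap_apply S (Localization.AtPrime 𝔮) (Localization.AtPrime 𝔮₀'.asIdeal) f, ← he]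
  exact (hι _ _ e _).symm

include hι₀

/-- A prime `𝔮₀'` of `S_𝔮` lies on the top `ι₀`-stratum of `f/1 ∈ S_𝔮` iff `ι₀ (S_{𝔮₀' ∩ S}) (f/1) = ι₀ (S_𝔮) (f/1)`.
[cite: Matsumura1987, Thm. 4.3] -/
theorem mem_topStratum_localization_iff (S : Type) [CommRing S] (𝔮 : Ideal S) [𝔮.IsPrime] (f : S)
    (𝔮₀' : PrimeSpectrum (Localization.AtPrime 𝔮)) :
    𝔮₀' ∈ topStratum ι₀ (Localization.AtPrime 𝔮) (algebraMap S (Localization.AtPrime 𝔮) f) ↔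
      ι₀ (Localization.AtPrime (𝔮₀'.asIdeal.comap (algebraMap S (Localization.AtPrime 𝔮)))) (algebraMap S _ f) =
        ι₀ (Localization.AtPrime 𝔮) (algebraMap S (Localization.AtPrime 𝔮) f) := by
  rw [mem_topStratum_iff, iota_atPrime_atPrime_eq hι₀]

/-- **The top `ι₀`-stratum under generisation**: if the top `ι₀`-stratum of `(S, f)` is `V(𝔭)` and `𝔭 ≤ 𝔮`, then the top
`ι₀`-stratum of `(S_𝔮, f/1)` is `V(𝔭 S_𝔮)` (the letter at `S_𝔮` equals the letter at `S` because `𝔮` lies on the stratum; the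
primes of `S_𝔮` are the primes `𝔮₀ ⊆ 𝔮` of `S` with the same local rings). [OURS · L1 W4.3 · (o44) (c7-cyl)] -/
theorem topStratum_localization_of_eq (S : Type) [CommRing S] (𝔭 𝔮 : Ideal S) [𝔭.IsPrime] [𝔮.IsPrime]
    (h𝔭𝔮 : 𝔭 ≤ 𝔮) (f : S) (hE : topStratum ι₀ S f = {𝔮₁ | 𝔭 ≤ 𝔮₁.asIdeal}) :
    topStratum ι₀ (Localization.AtPrime 𝔮) (algebraMap S (Localization.AtPrime 𝔮) f) =
      {𝔮₀' | 𝔭.map (algebraMap S (Localization.AtPrime 𝔮)) ≤ 𝔮₀'.asIdeal} := by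
  have h𝔮 : ι₀ (Localization.AtPrime 𝔮) (algebraMap S (Localization.AtPrime 𝔮) f) = ι₀ S f := by
    have : (⟨𝔮, ‹_›⟩ : PrimeSpectrum S) ∈ topStratum ι₀ S f := by rw [hE]; exact h𝔭𝔮
    exact this
  ext 𝔮₀'
  rw [mem_topStratum_localization_iff hι₀, h𝔮, Set.mem_setOf_eq, Ideal.map_le_iff_le_comap]
  have h := Set.ext_iff.mp hE ⟨𝔮₀'.asIdeal.comap (algebraMap S (Localization.AtPrime 𝔮)), inferInstance⟩
  rw [mem_topStratum_iff, Set.mem_setOf_eq] at h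
  exact h

/-- The generic prime of the top `ι₀`-stratum of `(S_𝔮, f/1)` is `𝔭 S_𝔮` when that of `(S, f)` is `V(𝔭)`, `𝔭 ≤ 𝔮`. [folklore] -/
theorem topStratumPrime_localization_eq (S : Type) [CommRing S] (𝔭 𝔮 : Ideal S) [𝔭.IsPrime] [𝔮.IsPrime]
    (h𝔭𝔮 : 𝔭 ≤ 𝔮) (f : S) (hE : topStratum ι₀ S f = {𝔮₁ | 𝔭 ≤ 𝔮₁.asIdeal})
    [(𝔭.map (algebraMap S (Localization.AtPrime 𝔮))).IsPrime] :
    topStratumPrime ι₀ (Localization.AtPrime 𝔮) (algebraMap S (Localization.AtPrime 𝔮) f) =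
      𝔭.map (algebraMap S (Localization.AtPrime 𝔮)) :=
  topStratumPrime_eq_of_topStratum_eq ι₀ _ _ (topStratum_localization_of_eq hι₀ S 𝔭 𝔮 h𝔭𝔮 f hE)

omit hι₀ in
/-- The first letter is kept at every prime of the stratum: `ι₀ (S_𝔮) (f/1) = ι₀ S f` for `𝔭 ≤ 𝔮`. [folklore] -/
theorem iota_localization_eq_of_topStratum_eq (S : Type) [CommRing S] (𝔭 𝔮 : Ideal S) [𝔭.IsPrime] [𝔮.IsPrime]
    (h𝔭𝔮 : 𝔭 ≤ 𝔮) (f : S) (hE : topStratum ι₀ S f = {𝔮₁ | 𝔭 ≤ 𝔮₁.asIdeal}) :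
    ι₀ (Localization.AtPrime 𝔮) (algebraMap S (Localization.AtPrime 𝔮) f) = ι₀ S f := by
  have : (⟨𝔮, ‹_›⟩ : PrimeSpectrum S) ∈ topStratum ι₀ S f := by rw [hE]; exact h𝔭𝔮
  exact this

/-- **(c7-cyl), EQUALITY FORM: the cylinder reading of a later letter LOCALISES along the stratum.**  For iso-invariant
letters `ι₀`, `ι₁`, any commutative `S`, `f` with `topStratum ι₀ S f = V(𝔭)` and a prime `𝔮 ⊇ 𝔭`:
`iotaCylinder ι₀ ι₁ (S_𝔮) (f/1) = iotaCylinder ι₀ ι₁ S f` — both are `ι₁` read in `S_𝔭 ≅ (S_𝔮)_{𝔭 S_𝔮}`.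
[OURS · L1 W4.3 · (o44) (c7-cyl)] -/
theorem iotaCylinder_localization_eq {ι₁ : (R : Type) → [CommRing R] → R → Ordinal.{0}} (hι₁ : IotaIsoInvariant ι₁)
    (S : Type) [CommRing S] (𝔭 𝔮 : Ideal S) [𝔭.IsPrime] [𝔮.IsPrime] (h𝔭𝔮 : 𝔭 ≤ 𝔮) (f : S)
    (hE : topStratum ι₀ S f = {𝔮₁ | 𝔭 ≤ 𝔮₁.asIdeal}) :
    iotaCylinder ι₀ ι₁ (Localization.AtPrime 𝔮) (algebraMap S (Localization.AtPrime 𝔮) f) = iotaCylinder ι₀ ι₁ S f := by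
  haveI := isPrime_map_atPrime_of_le 𝔭 𝔮 h𝔭𝔮
  haveI := isLocalizationAtPrime_atPrime_map 𝔭 𝔮 h𝔭𝔮
  rw [iotaCylinder_eq_of_topStratum_eq ι₀ ι₁ _ _ (topStratum_localization_of_eq hι₀ S 𝔭 𝔮 h𝔭𝔮 f hE),
    iotaCylinder_eq_of_topStratum_eq ι₀ ι₁ S f hE,
    ← IsScalarTower.algebraMap_apply S (Localization.AtPrime 𝔮) _ f]
  -- `(S_𝔮)_{𝔭 S_𝔮} ≅ S_𝔭` over `S`
  let e : Localization.AtPrime (𝔭.map (algebraMap S (Localization.AtPrime 𝔮))) ≃+* Localization.AtPrime 𝔭 :=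
    (IsLocalization.algEquiv 𝔭.primeCompl
      (Localization.AtPrime (𝔭.map (algebraMap S (Localization.AtPrime 𝔮)))) (Localization.AtPrime 𝔭)).toRingEquiv
  have he : e (algebraMap S _ f) = algebraMap S (Localization.AtPrime 𝔭) f :=
    (IsLocalization.algEquiv 𝔭.primeCompl
      (Localization.AtPrime (𝔭.map (algebraMap S (Localization.AtPrime 𝔮)))) (Localization.AtPrime 𝔭)).commutes f
  rw [← he]
  exact (hι₁ _ _ e _).symm

/-- **(J-loc) for the cylinder construction over ANY iso-invariant pair**: with `topStratum ι₀ S f = V(𝔭)` and `𝔮 ⊇ 𝔭`,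
`jCylinder ι₀ J (S_𝔮) (f/1) m = (jCylinder ι₀ J S f m)·S_𝔮` (res-D-brk-1's `cylinderAt_localization`, p527245, and the
localisation of the top stratum). [OURS · L1 W4.3 · (o44) (c7-cyl)] -/
theorem jCylinder_localization {J : (R : Type) → [CommRing R] → R → ℕ → Ideal R} (hJ : JIsoInvariant J)
    (S : Type) [CommRing S] (𝔭 𝔮 : Ideal S) [𝔭.IsPrime] [𝔮.IsPrime] (h𝔭𝔮 : 𝔭 ≤ 𝔮) (f : S)
    (hE : topStratum ι₀ S f = {𝔮₁ | 𝔭 ≤ 𝔮₁.asIdeal}) (m : ℕ) :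
    jCylinder ι₀ J (Localization.AtPrime 𝔮) (algebraMap S (Localization.AtPrime 𝔮) f) m =
      (jCylinder ι₀ J S f m).map (algebraMap S (Localization.AtPrime 𝔮)) := by
  haveI := isPrime_map_atPrime_of_le 𝔭 𝔮 h𝔭𝔮
  rw [jCylinder_eq_of_topStratum_eq ι₀ J _ _ m (topStratum_localization_of_eq hι₀ S 𝔭 𝔮 h𝔭𝔮 f hE),
    jCylinder_eq_of_topStratum_eq ι₀ J S f m hE]
  exact cylinderAt_localization J hJ S 𝔭 𝔮 h𝔭𝔮 f m

/-- **(c7-cyl) at a position with the (strat) property** — the binder shape of `IotaGenerizationMonotoneOn ι₀ (iotaCylinder ι₀ ι₁)`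
at ONE position: if the top `ι₀`-stratum of `(S, f)` is `V(𝔭)` for a prime `𝔭`, then at every prime `𝔮` where `ι₀` is
stationary the cylinder reading does not increase (it is equal). [OURS · L1 W4.3 · (o44) (c7-cyl)] -/
theorem iotaCylinder_localization_le_of_strat {ι₁ : (R : Type) → [CommRing R] → R → Ordinal.{0}} (hι₁ : IotaIsoInvariant ι₁)
    (S : Type) [CommRing S] {𝔭 : Ideal S} [𝔭.IsPrime] (f : S) (hE : topStratum ι₀ S f = {𝔮₁ | 𝔭 ≤ 𝔮₁.asIdeal})
    (𝔮 : Ideal S) [𝔮.IsPrime] (h𝔮 : ι₀ (Localization.AtPrime 𝔮) (algebraMap S (Localization.AtPrime 𝔮) f) = ι₀ S f) :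
    iotaCylinder ι₀ ι₁ (Localization.AtPrime 𝔮) (algebraMap S (Localization.AtPrime 𝔮) f) ≤ iotaCylinder ι₀ ι₁ S f := by
  have h𝔭𝔮 : 𝔭 ≤ 𝔮 := by
    have : (⟨𝔮, ‹_›⟩ : PrimeSpectrum S) ∈ topStratum ι₀ S f := h𝔮
    rw [hE] at this
    exact this
  exact (iotaCylinder_localization_eq hι₀ hι₁ S 𝔭 𝔮 h𝔭𝔮 f hE).le

/-- **(c7) for the nested letter at a position with the (strat) property.**  With `ι₁` bounded by `Λ`, (c7) for `ι₀` AT THIS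
position (`ι₀ (S_𝔮) (f/1) ≤ ι₀ S f`), and `topStratum ι₀ S f = V(𝔭)`:
`iotaLex Λ ι₀ (iotaCylinder ι₀ ι₁) (S_𝔮) (f/1) ≤ iotaLex Λ ι₀ (iotaCylinder ι₀ ι₁) S f` — the (c7)≤3 obligation of
`ι₃ᵗ = iotaLex Λ ι₀ (iotaCylinder ι₀ iotaSigma)` at every position of the rung where the (strat) certificate holds, with NO
monotonicity asked of `σ`. [OURS · L1 W4.3 · (o44) (c7-cyl)] -/
theorem iotaLex_iotaCylinder_localization_le {ι₁ : (R : Type) → [CommRing R] → R → Ordinal.{0}} (hι₁ : IotaIsoInvariant ι₁)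
    {Λ : Ordinal.{0}} (hb : IotaBoundedBy Λ (iotaCylinder ι₀ ι₁)) (S : Type) [CommRing S] {𝔭 : Ideal S} [𝔭.IsPrime] (f : S)
    (hE : topStratum ι₀ S f = {𝔮₁ | 𝔭 ≤ 𝔮₁.asIdeal}) (𝔮 : Ideal S) [𝔮.IsPrime]
    (h7 : ι₀ (Localization.AtPrime 𝔮) (algebraMap S (Localization.AtPrime 𝔮) f) ≤ ι₀ S f) :
    iotaLex Λ ι₀ (iotaCylinder ι₀ ι₁) (Localization.AtPrime 𝔮) (algebraMap S (Localization.AtPrime 𝔮) f) ≤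
      iotaLex Λ ι₀ (iotaCylinder ι₀ ι₁) S f :=
  iotaLex_le_of hb h7 fun h𝔮 => iotaCylinder_localization_le_of_strat hι₀ hι₁ S f hE 𝔮 h𝔮

omit hι₀ in
/-- A bound on `ι₁` bounds its cylinder reading (for `iotaLex_iotaCylinder_localization_le`'s `hb`). [folklore] -/
theorem iotaBoundedBy_iotaCylinder {ι₁ : (R : Type) → [CommRing R] → R → Ordinal.{0}} {Λ : Ordinal.{0}}
    (hb : IotaBoundedBy Λ ι₁) : IotaBoundedBy Λ (iotaCylinder ι₀ ι₁) := by
  intro R _ g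
  by_cases h : (topStratumPrime ι₀ R g).IsPrime
  · rw [iotaCylinder_eq_iotaAtPrime ι₀ ι₁ R g (h := h), iotaAtPrime_def]
    exact hb _ _
  · rw [iotaCylinder_of_not_isPrime ι₀ ι₁ R g h]
    exact hb R g

end Strat

end ContactCylinder

end Summit.ResolutionOfSingularities.ResolutionOfSingularities.Theorems

end
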